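import Literature.NumberTheory.GaloisRepresentations.UnitIdelesHerbrand
import Mathlib.GroupTheory.GroupAction.Period
import Mathlib.GroupTheory.GroupAction.Quotient
import Mathlib.Data.ZMod.QuotientGroup
import Mathlib.Algebra.Group.Subgroup.ZPowers.Lemmas
import HarnessLib

/-!
# The Herbrand quotient of a permutation lattice (Childress Prop. 5.10, lattice step)

Topic `NumberTheory/GaloisRepresentations` (class field theory: Childress, *Class Field Theory*,
Ch. 4 §5 proof of Prop. 5.10, PDF p. 101: "`L' ≅ ⊕_{v ∈ S_∞} ℤ[G/G_{w_v}]`, `#Ĥ⁰ = ∏ #G_w`,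
`Ĥ¹ = 1` by Shapiro"); namespace `Literature.NumberTheory.GaloisRepresentations.PermLattice`.
Definitions with their API; everything **proved**, in the index language of
`CyclicHerbrandQuotient.lean` and without Shapiro's lemma (direct computation).

* `PermLattice.PermMod X` — the permutation lattice `ℤ[X] = (X → ℤ)` of a `G`-set `X`, written
  multiplicatively (`Multiplicative`), with `(g • f)(x) = f (g⁻¹ x)`;
* `PermLattice.orbitMod x₀ ≤ PermMod X` — the functions supported on the orbit of `x₀`;
* **`PermLattice.h1_top_eq_one`**: `#Ĥ⁻¹(⟨σ⟩, ℤ[X]) = 1`;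
* **`PermLattice.h0_top_eq_prod`**: `#Ĥ⁰(⟨σ⟩, ℤ[X]) = ∏_{orbits} #Stab`, in the form
  `∏_{y : Y} #G_{s y}` for any system `s : Y → X` of orbit representatives.

## References

* N. Childress, *Class Field Theory*, Universitext, Springer 2009, Ch. 4 §5 Prop. 5.10 (proof)
  (PDF p. 101). [Childress2009]
-/

noncomputable section

namespace Literature.NumberTheory.GaloisRepresentations

namespace PermLattice

open scoped Classical

variable {G : Type*} [Group G] {X : Type*} [MulAction G X]

/-! ### The permutation lattice -/

variable (X) in
/-- The permutation lattice `ℤ[X] = (X → ℤ)`, written multiplicatively. [folklore] -/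
def PermMod (X : Type*) : Type _ := Multiplicative (X → ℤ)

/-- `:` (API). [folklore] -/
instance : CommGroup (PermMod X) := inferInstanceAs (CommGroup (Multiplicative (X → ℤ)))

namespace PermMod

/-- Coordinates. [folklore] -/
def val (f : PermMod X) (x : X) : ℤ := Multiplicative.toAdd f x

/-- Constructor from coordinates. [folklore] -/
def mk (f : X → ℤ) : PermMod X := Multiplicative.ofAdd f

/-- `val_mk` (API). [folklore] -/
@[simp] theorem val_mk (f : X → ℤ) (x : X) : (mk f : PermMod X).val x = f x := rfl

/-- `ext` (API). [folklore] -/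
@[ext] theorem ext {f g : PermMod X} (h : ∀ x, f.val x = g.val x) : f = g :=
  Multiplicative.toAdd.injective (funext h)

/-- `val_one` (API). [folklore] -/
@[simp] theorem val_one (x : X) : (1 : PermMod X).val x = 0 := rfl
/-- `val_mul` (API). [folklore] -/
@[simp] theorem val_mul (f g : PermMod X) (x : X) : (f * g).val x = f.val x + g.val x := rfl
/-- `val_inv` (API). [folklore] -/
@[simp] theorem val_inv (f : PermMod X) (x : X) : f⁻¹.val x = -f.val x := rfl
/-- `val_div` (API). [folklore] -/
@[simp] theorem val_div (f g : PermMod X) (x : X) : (f / g).val x = f.val x - g.val x := by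
  rw [div_eq_mul_inv, val_mul, val_inv, sub_eq_add_neg]
/-- `val_pow` (API). [folklore] -/
@[simp] theorem val_pow (f : PermMod X) (k : ℕ) (x : X) : (f ^ k).val x = k * f.val x := by
  induction k with
  | zero => simp
  | succ k ih => rw [pow_succ, val_mul, ih]; push_cast; ring
/-- `val_zpow` (API). [folklore] -/
@[simp] theorem val_zpow (f : PermMod X) (k : ℤ) (x : X) : (f ^ k).val x = k * f.val x := by
  rcases k with k | k
  · simp
  · rw [zpow_negSucc, val_inv, val_pow, Int.negSucc_eq]; push_cast; ring
/-- `val_prod` (API). [folklore] -/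
theorem val_prod {ι : Type*} (s : Finset ι) (f : ι → PermMod X) (x : X) :
    (∏ i ∈ s, f i).val x = ∑ i ∈ s, (f i).val x := by
  induction s using Finset.induction_on with
  | empty => rfl
  | insert a s ha ih => rw [Finset.prod_insert ha, Finset.sum_insert ha, val_mul, ih]

/-- The action `(g • f)(x) = f(g⁻¹ x)`. [folklore] -/
instance : MulDistribMulAction G (PermMod X) where
  smul g f := mk fun x => f.val (g⁻¹ • x)
  one_smul f := by
    ext x
    show f.val ((1 : G)⁻¹ • x) = f.val x
    rw [inv_one, one_smul]
  mul_smul g h f := by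
    ext x
    show f.val ((g * h)⁻¹ • x) = f.val (h⁻¹ • g⁻¹ • x)
    rw [mul_inv_rev, mul_smul]
  smul_mul g f f' := by ext x; rfl
  smul_one g := by ext x; rfl

/-- `val_smul` (API). [folklore] -/
@[simp] theorem val_smul (g : G) (f : PermMod X) (x : X) : (g • f).val x = f.val (g⁻¹ • x) := rfl

/-- The basis vector `e_x`. [folklore] -/
def single (x₀ : X) : PermMod X := mk fun x => if x = x₀ then 1 else 0

/-- `val_single` (API). [folklore] -/
theorem val_single (x₀ x : X) : (single x₀ : PermMod X).val x = if x = x₀ then 1 else 0 := rfl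

/-- `smul_single` (API). [folklore] -/
theorem smul_single (g : G) (x₀ : X) : g • (single x₀ : PermMod X) = single (g • x₀) := by
  ext x
  rw [val_smul, val_single, val_single]
  by_cases h : x = g • x₀
  · rw [if_pos h, if_pos (by rw [h, inv_smul_smul])]
  · rw [if_neg h, if_neg (fun h' => h (by rw [← h', smul_inv_smul]))]

/-- Every element is `∏_x e_x ^ {f x}` (finite `X`). [folklore] -/
theorem prod_single_zpow [Fintype X] (f : PermMod X) : ∏ x, (single x : PermMod X) ^ f.val x = f := by
  ext y
  rw [val_prod, Finset.sum_eq_single y]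
  · rw [val_zpow, val_single, if_pos rfl, mul_one]
  · intro x _ hxy; rw [val_zpow, val_single, if_neg (Ne.symm hxy), mul_zero]
  · intro h; exact absurd (Finset.mem_univ y) h

end PermMod

open PermMod

/-! ### Norm and `σ - 1` in coordinates -/

variable [Fintype G]

/-- The norm in coordinates: `(N f)(x) = ∑_g f(g x)`. [folklore] -/
theorem val_norm (f : PermMod X) (x : X) : (Herbrand.norm G f).val x = ∑ g : G, f.val (g • x) := by
  rw [Herbrand.norm_apply, val_prod]
  exact Fintype.sum_equiv (Equiv.inv G) _ _ fun g => by simp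

omit [Fintype G] in
/-- `val_twist` (API). [folklore] -/
theorem val_twist (σ : G) (f : PermMod X) (x : X) : (Herbrand.twist σ f).val x = f.val (σ⁻¹ • x) - f.val x := by
  rw [Herbrand.twist_apply, val_div, val_smul]

/-! ### Orbits of a cyclic group: exponents -/

section Cyclic

variable {σ : G} (hσ : ∀ g : G, g ∈ Subgroup.zpowers σ)
include hσ

omit [Fintype G] in
/-- In `G = ⟨σ⟩`, the orbit of `x₀` is `{σ^j x₀ : j < period}`. [folklore] -/
theorem exists_lt_period_pow_smul_eq [Fintype G] {x₀ x : X} (hx : x ∈ MulAction.orbit G x₀) :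
    ∃ j < MulAction.period σ x₀, σ ^ j • x₀ = x := by
  obtain ⟨g, rfl⟩ := hx
  obtain ⟨k, rfl⟩ := Subgroup.mem_zpowers_iff.mp (hσ g)
  have hp : 0 < MulAction.period σ x₀ :=
    MulAction.period_pos_of_orderOf_pos (orderOf_pos σ) x₀
  refine ⟨(k % (MulAction.period σ x₀ : ℤ)).toNat, ?_, ?_⟩
  · have h1 := Int.emod_lt_of_pos k (by exact_mod_cast hp : (0 : ℤ) < MulAction.period σ x₀)
    have h0 := Int.emod_nonneg k (by exact_mod_cast hp.ne' : (MulAction.period σ x₀ : ℤ) ≠ 0)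
    omega
  · show σ ^ (k % (MulAction.period σ x₀ : ℤ)).toNat • x₀ = σ ^ k • x₀
    rw [← MulAction.zpow_mod_period_smul k, ← zpow_natCast,
      Int.toNat_of_nonneg (Int.emod_nonneg k (by exact_mod_cast
        (MulAction.period_pos_of_orderOf_pos (orderOf_pos σ) x₀).ne'))]

omit [Fintype G] hσ in
/-- Exponents below the period are unique. [folklore] -/
theorem pow_smul_injOn (σ : G) (x₀ : X) {i j : ℕ} (hi : i < MulAction.period σ x₀) (hj : j < MulAction.period σ x₀)
    (h : σ ^ i • x₀ = σ ^ j • x₀) : i = j := by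
  wlog hij : i ≤ j generalizing i j
  · exact (this hj hi h.symm (le_of_not_ge hij)).symm
  have : σ ^ (j - i) • x₀ = x₀ := by
    have h' : σ⁻¹ ^ i • σ ^ i • x₀ = σ⁻¹ ^ i • σ ^ j • x₀ := by rw [h]
    rw [inv_pow, inv_smul_smul, ← zpow_natCast, ← zpow_natCast, ← zpow_neg, smul_smul, ← zpow_add,
      show -(i : ℤ) + j = ((j - i : ℕ) : ℤ) by omega, zpow_natCast] at h'
    exact h'.symm
  by_contra hne
  exact MulAction.pow_smul_ne_of_lt_period (by omega) (by omega) this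

end Cyclic

/-! ### The sublattice supported on an orbit -/

variable (G) in
/-- The functions supported on the orbit of `x₀`. [folklore] -/
def orbitMod (x₀ : X) : Subgroup (PermMod X) where
  carrier := {f | ∀ x, x ∉ MulAction.orbit G x₀ → f.val x = 0}
  one_mem' := fun x _ => rfl
  mul_mem' := fun {f g} hf hg x hx => by rw [val_mul, hf x hx, hg x hx, add_zero]
  inv_mem' := fun {f} hf x hx => by rw [val_inv, hf x hx, neg_zero]

omit [Fintype G] in
/-- `mem_orbitMod_iff` (API). [folklore] -/
theorem mem_orbitMod_iff {x₀ : X} {f : PermMod X} :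
    f ∈ orbitMod G x₀ ↔ ∀ x, x ∉ MulAction.orbit G x₀ → f.val x = 0 := Iff.rfl

omit [Fintype G] in
/-- `orbitMod` is stable. [folklore] -/
theorem isStable_orbitMod (x₀ : X) : Herbrand.IsStable G (orbitMod G x₀) := by
  intro g f hf x hx
  rw [val_smul]
  refine hf _ fun h => hx ?_
  obtain ⟨g', hg'⟩ := h
  refine ⟨g * g', ?_⟩
  simp only at hg' ⊢
  rw [mul_smul, hg', smul_inv_smul]

/-! ### One orbit of a cyclic group -/

section Orbit

variable {σ : G} (hσ : ∀ g : G, g ∈ Subgroup.zpowers σ) (x₀ : X)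
include hσ

/-- Sums over `G = ⟨σ⟩` are sums over `σ^k`, `k < #G`. [folklore] -/
theorem sum_range_card_pow_eq_sum {A : Type*} [AddCommMonoid A] (F : G → A) :
    ∑ k ∈ Finset.range (Fintype.card G), F (σ ^ k) = ∑ g, F g := by
  have ho : orderOf σ = Fintype.card G := by
    rw [← Nat.card_eq_fintype_card]; exact orderOf_eq_card_of_forall_mem_zpowers hσ
  have hinj : ∀ i ∈ Finset.range (Fintype.card G), ∀ j ∈ Finset.range (Fintype.card G),
      σ ^ i = σ ^ j → i = j := by
    intro i hi j hj h
    rw [Finset.mem_range, ← ho] at hi hj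
    exact pow_injOn_Iio_orderOf (Set.mem_Iio.mpr hi) (Set.mem_Iio.mpr hj) h
  have himg : (Finset.range (Fintype.card G)).image (fun i => σ ^ i) = Finset.univ := by
    apply Finset.eq_univ_of_card
    rw [Finset.card_image_of_injOn (fun i hi j hj h => hinj i hi j hj h), Finset.card_range]
  rw [← himg, Finset.sum_image hinj]

omit [Fintype G] hσ in
/-- `σ^(period)` fixes `x₀`, so exponents only matter modulo the period. [folklore] -/
theorem pow_add_mul_period_smul (j q : ℕ) : σ ^ (j + MulAction.period σ x₀ * q) • x₀ = σ ^ j • x₀ := by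
  rw [pow_add, mul_smul, MulAction.pow_smul_eq_iff_period_dvd.mpr (dvd_mul_right _ _)]

/-- The period divides `#G`. [folklore] -/
theorem period_dvd_card : MulAction.period σ x₀ ∣ Fintype.card G := by
  rw [← Nat.card_eq_fintype_card, ← orderOf_eq_card_of_forall_mem_zpowers hσ]
  exact MulAction.period_dvd_orderOf σ x₀

omit hσ in
/-- The period is positive. [folklore] -/
theorem period_pos' : 0 < MulAction.period σ x₀ :=
  MulAction.period_pos_of_orderOf_pos (orderOf_pos σ) x₀

/-- **The norm at `x₀` is `(#G / period) ·` the sum over the `σ`-orbit.** [folklore] -/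
theorem val_norm_eq (f : PermMod X) :
    (Herbrand.norm G f).val x₀ = (Fintype.card G / MulAction.period σ x₀ : ℕ) *
      ∑ j ∈ Finset.range (MulAction.period σ x₀), f.val (σ ^ j • x₀) := by
  set m := MulAction.period σ x₀ with hm
  obtain ⟨q, hq⟩ := period_dvd_card hσ x₀
  have hmpos : 0 < m := period_pos' x₀
  rw [val_norm, ← sum_range_card_pow_eq_sum hσ (fun g => f.val (g • x₀)), hq, Nat.mul_div_cancel_left q hmpos]
  -- periodicity
  have key : ∀ q' : ℕ, ∑ k ∈ Finset.range (m * q'), f.val (σ ^ k • x₀) =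
      q' * ∑ j ∈ Finset.range m, f.val (σ ^ j • x₀) := by
    intro q'
    induction q' with
    | zero => simp
    | succ q' ih =>
      rw [Nat.mul_succ, Finset.sum_range_add, ih]
      push_cast
      rw [add_mul, one_mul]
      congr 1
      refine Finset.sum_congr rfl fun j _ => ?_
      rw [add_comm, pow_add_mul_period_smul]
  rw [key q]

variable (G) in
omit [Fintype G] hσ in
/-- The indicator function of the orbit of `x₀`. [folklore] -/
def ind (x₀ : X) : PermMod X := PermMod.mk fun x => if x ∈ MulAction.orbit G x₀ then 1 else 0

omit [Fintype G] hσ in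
/-- `val_ind` (API). [folklore] -/
theorem val_ind (x : X) : (ind G x₀).val x = if x ∈ MulAction.orbit G x₀ then 1 else 0 := rfl

omit [Fintype G] hσ in
/-- `ind_mem_orbitMod` (API). [folklore] -/
theorem ind_mem_orbitMod : ind G x₀ ∈ orbitMod G x₀ := fun x hx => by rw [val_ind, if_neg hx]

omit [Fintype G] hσ in
/-- `smul_ind` (API). [folklore] -/
theorem smul_ind (g : G) : g • ind G x₀ = ind G x₀ := by
  ext x; rw [val_smul, val_ind, val_ind, MulAction.mem_orbit_iff, MulAction.mem_orbit_iff]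
  simp only [show (∃ g', g' • x₀ = g⁻¹ • x) ↔ ∃ g', g' • x₀ = x from
    ⟨fun ⟨g', h⟩ => ⟨g * g', by rw [mul_smul, h, smul_inv_smul]⟩,
     fun ⟨g', h⟩ => ⟨g⁻¹ * g', by rw [mul_smul, h]⟩⟩]

omit [Fintype G] hσ in
/-- `k ↦ (ind x₀)^k` is injective (look at `x₀`). [folklore] -/
theorem ind_zpow_injective : Function.Injective fun k : ℤ => (ind G x₀) ^ k := by
  intro k k' h
  have := congrArg (fun f : PermMod X => f.val x₀) h
  simpa [val_zpow, val_ind, MulAction.mem_orbit_self] using this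

/-- A `σ`-fixed function supported on the orbit is a multiple of the indicator. [folklore] -/
theorem eq_ind_zpow_of_fixed {f : PermMod X} (hf : f ∈ orbitMod G x₀) (hfix : σ • f = f) :
    f = (ind G x₀) ^ f.val x₀ := by
  have hconst : ∀ k : ℕ, f.val (σ ^ k • x₀) = f.val x₀ := by
    intro k
    induction k with
    | zero => rw [pow_zero, one_smul]
    | succ k ih =>
      have := congrArg (fun h : PermMod X => h.val (σ ^ (k + 1) • x₀)) hfix
      simp only [val_smul] at this
      rw [← this, pow_succ', mul_smul, inv_smul_smul, ih]
  ext x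
  rw [val_zpow, val_ind]
  by_cases hx : x ∈ MulAction.orbit G x₀
  · obtain ⟨j, -, rfl⟩ := exists_lt_period_pow_smul_eq hσ hx
    rw [if_pos hx, mul_one, hconst]
  · rw [if_neg hx, mul_zero, hf x hx]

/-- **The fixed points of `orbitMod`**: the powers of the indicator. [folklore] -/
theorem z0_orbitMod_eq : Herbrand.z0 σ (orbitMod G x₀) ⊥ = Subgroup.zpowers (ind G x₀) := by
  apply le_antisymm
  · intro f hf
    obtain ⟨hfO, hfix⟩ := Herbrand.mem_z0_bot.mp hf
    rw [eq_ind_zpow_of_fixed hσ x₀ hfO hfix]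
    exact Subgroup.zpow_mem_zpowers _ _
  · rw [Subgroup.zpowers_le]
    exact Herbrand.mem_z0_bot.mpr ⟨ind_mem_orbitMod x₀, smul_ind x₀ σ⟩

/-- The norm of a function supported on the orbit is `(#G/period) · (orbit sum)` times the
indicator. [folklore] -/
theorem norm_eq_ind_zpow {f : PermMod X} (hf : f ∈ orbitMod G x₀) :
    Herbrand.norm G f = (ind G x₀) ^ ((Fintype.card G / MulAction.period σ x₀ : ℕ) *
      ∑ j ∈ Finset.range (MulAction.period σ x₀), f.val (σ ^ j • x₀)) := by
  have hNO : Herbrand.norm G f ∈ orbitMod G x₀ := (isStable_orbitMod x₀).norm_mem hf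
  rw [eq_ind_zpow_of_fixed hσ x₀ hNO (Herbrand.smul_norm σ f), val_norm_eq hσ x₀]

/-- The norm of `e_{x₀}` is `(#G/period)` times the indicator. [folklore] -/
theorem norm_single : Herbrand.norm G (single x₀ : PermMod X) =
    (ind G x₀) ^ (Fintype.card G / MulAction.period σ x₀ : ℕ) := by
  have hmem : (single x₀ : PermMod X) ∈ orbitMod G x₀ := fun x hx => by
    rw [val_single, if_neg]; rintro rfl; exact hx (MulAction.mem_orbit_self _)
  rw [norm_eq_ind_zpow hσ x₀ hmem, Finset.sum_eq_single 0]
  · rw [pow_zero, one_smul, val_single, if_pos rfl, mul_one, zpow_natCast]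
  · intro j hj hj0
    rw [val_single, if_neg]
    intro h
    exact hj0 (pow_smul_injOn σ x₀ (Finset.mem_range.mp hj) (period_pos' x₀) (by rw [h, pow_zero, one_smul]))
  · intro h; exact absurd (Finset.mem_range.mpr (period_pos' x₀)) h

/-- **The norms of `orbitMod`**: the powers of `ind ^ (#G/period)`. [folklore] -/
theorem b0_orbitMod_eq : Herbrand.b0 G (orbitMod G x₀) ⊥ =
    Subgroup.zpowers ((ind G x₀) ^ (Fintype.card G / MulAction.period σ x₀ : ℕ)) := by
  rw [Herbrand.b0_bot]
  apply le_antisymm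
  · rintro _ ⟨f, hf, rfl⟩
    rw [norm_eq_ind_zpow hσ x₀ hf, zpow_mul, zpow_natCast]
    exact Subgroup.zpow_mem_zpowers _ _
  · rw [Subgroup.zpowers_le, ← norm_single hσ x₀]
    refine ⟨single x₀, fun x hx => ?_, rfl⟩
    rw [val_single, if_neg]; rintro rfl; exact hx (MulAction.mem_orbit_self _)

omit [MulAction G X] [Fintype G] hσ in
/-- `[⟨a⟩ : ⟨a^s⟩] = s` for `k ↦ a^k` injective. [folklore] -/
theorem relIndex_zpowers_pow {M : Type*} [CommGroup M] (a : M) (ha : Function.Injective fun k : ℤ => a ^ k)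
    (s : ℕ) : (Subgroup.zpowers (a ^ s)).relIndex (Subgroup.zpowers a) = s := by
  have hφ : Function.Injective (zpowersHom M a) := fun k k' h => by
    have : a ^ (Multiplicative.toAdd k) = a ^ (Multiplicative.toAdd k') := h
    exact Multiplicative.toAdd.injective (ha this)
  have h1 : Subgroup.zpowers (a ^ s) = (Subgroup.zpowers (Multiplicative.ofAdd (s : ℤ))).map (zpowersHom M a) := by
    rw [MonoidHom.map_zpowers]; congr 1; simp [zpowersHom_apply]
  have h2 : Subgroup.zpowers a = (⊤ : Subgroup (Multiplicative ℤ)).map (zpowersHom M a) := by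
    rw [← MonoidHom.range_eq_map]; rfl
  rw [h1, h2, Subgroup.relIndex_map_map_of_injective _ _ hφ, Subgroup.relIndex_top_right]
  have : (Subgroup.zpowers (Multiplicative.ofAdd (s : ℤ))).index =
      (AddSubgroup.zmultiples (s : ℤ)).index := by
    rw [← AddSubgroup.index_toSubgroup]; congr 1
  rw [this, Int.index_zmultiples, Int.natAbs_natCast]

/-- **`#Ĥ⁰(⟨σ⟩, ℤ[orbit]) = #G / period = #Stab`.** [cite: Childress2009, Ch. 4 §5 Prop. 5.10 (proof) (PDF p. 101)] -/
theorem h0_orbitMod_eq : Herbrand.h0 σ (orbitMod G x₀) ⊥ = Fintype.card G / MulAction.period σ x₀ := by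
  rw [Herbrand.h0_def, z0_orbitMod_eq hσ x₀, b0_orbitMod_eq hσ x₀]
  exact relIndex_zpowers_pow _ (ind_zpow_injective x₀) _

/-- **`#Ĥ⁻¹(⟨σ⟩, ℤ[orbit]) = 1`**: a function on the orbit with orbit sum `0` is `h(σ⁻¹·) - h` for
the partial sums `h` along `x₀, σx₀, σ²x₀, …`. [cite: Childress2009, Ch. 4 §5 Prop. 5.10 (proof) (PDF p. 101)] -/
theorem h1_orbitMod_eq_one : Herbrand.h1 σ (orbitMod G x₀) ⊥ = 1 := by
  set m := MulAction.period σ x₀ with hm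
  have hmpos : 0 < m := period_pos' x₀
  rw [Herbrand.h1_eq_one_iff]
  intro f hf hN
  rw [Subgroup.mem_bot] at hN
  -- orbit sum is zero
  have hsum : ∑ j ∈ Finset.range m, f.val (σ ^ j • x₀) = 0 := by
    have h := val_norm_eq hσ x₀ f
    rw [hN, val_one] at h
    obtain ⟨q, hq⟩ := period_dvd_card hσ x₀
    have hq0 : (Fintype.card G / m : ℕ) ≠ 0 := by
      rw [hq, Nat.mul_div_cancel_left q hmpos]
      rintro rfl; rw [mul_zero] at hq; exact Fintype.card_ne_zero hq
    rcases mul_eq_zero.mp h.symm with h0 | h0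
    · exact absurd (by exact_mod_cast h0) hq0
    · exact h0
  -- the exponent function on the orbit
  have hex : ∀ x, x ∈ MulAction.orbit G x₀ → ∃ j < m, σ ^ j • x₀ = x := fun x hx =>
    exists_lt_period_pow_smul_eq hσ hx
  choose! e he₁ he₂ using hex
  have he : ∀ j < m, e (σ ^ j • x₀) = j := fun j hj =>
    pow_smul_injOn σ x₀ (he₁ _ ⟨σ ^ j, rfl⟩) hj (he₂ _ ⟨σ ^ j, rfl⟩)
  -- the primitive
  set h : PermMod X := PermMod.mk fun x =>
    if x ∈ MulAction.orbit G x₀ then -∑ i ∈ Finset.range (e x + 1), f.val (σ ^ i • x₀) else 0 with hh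
  have hval : ∀ x, h.val x =
      if x ∈ MulAction.orbit G x₀ then -∑ i ∈ Finset.range (e x + 1), f.val (σ ^ i • x₀) else 0 := fun x => rfl
  have hmem : h ∈ orbitMod G x₀ := fun x hx => by rw [hval, if_neg hx]
  rw [Herbrand.b1_bot]
  refine ⟨h, hmem, ?_⟩
  ext x
  rw [val_twist]
  by_cases hx : x ∈ MulAction.orbit G x₀
  · obtain ⟨j, hj, rfl⟩ := exists_lt_period_pow_smul_eq hσ hx
    have hO : ∀ k : ℕ, σ ^ k • x₀ ∈ MulAction.orbit G x₀ := fun k => ⟨σ ^ k, rfl⟩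
    rcases Nat.eq_zero_or_pos j with rfl | hjpos
    · -- `x = x₀`: `σ⁻¹ x₀ = σ^(m-1) x₀`
      have hprev : σ⁻¹ • σ ^ 0 • x₀ = σ ^ (m - 1) • x₀ := by
        rw [pow_zero, one_smul, inv_smul_eq_iff, smul_smul, ← pow_succ',
          Nat.sub_add_cancel hmpos, MulAction.pow_period_smul]
      rw [hprev, hval, hval, if_pos (hO _), if_pos (hO _), he _ (Nat.sub_lt hmpos one_pos), he 0 hmpos,
        Nat.sub_one_add_one_eq_of_pos hmpos, hsum, zero_add, Finset.sum_range_one, pow_zero, one_smul]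
      ring
    · have hprev : σ⁻¹ • σ ^ j • x₀ = σ ^ (j - 1) • x₀ := by
        rw [inv_smul_eq_iff, smul_smul, ← pow_succ', Nat.sub_add_cancel hjpos]
      rw [hprev, hval, hval, if_pos (hO _), if_pos (hO _), he _ (by omega), he j hj,
        Nat.sub_one_add_one_eq_of_pos hjpos, Finset.sum_range_succ]
      ring
  · have hx' : σ⁻¹ • x ∉ MulAction.orbit G x₀ := fun ⟨g, hg⟩ => hx ⟨σ * g, by
      simp only at hg ⊢; rw [mul_smul, hg, smul_inv_smul]⟩
    rw [hval, hval, if_neg hx, if_neg hx', hf x hx, sub_zero]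

/-- The orbit of `x₀` under `G = ⟨σ⟩` has `period σ x₀` elements. [folklore] -/
theorem card_orbit_eq_period : Nat.card (MulAction.orbit G x₀) = MulAction.period σ x₀ := by
  have hbij : Function.Bijective (fun i : Fin (MulAction.period σ x₀) =>
      (⟨σ ^ (i : ℕ) • x₀, σ ^ (i : ℕ), rfl⟩ : MulAction.orbit G x₀)) := by
    constructor
    · intro i j h
      exact Fin.ext (pow_smul_injOn σ x₀ i.2 j.2 (congrArg Subtype.val h))
    · rintro ⟨x, hx⟩
      obtain ⟨j, hj, rfl⟩ := exists_lt_period_pow_smul_eq hσ hx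
      exact ⟨⟨j, hj⟩, rfl⟩
  rw [← Nat.card_eq_of_bijective _ hbij, Nat.card_eq_fintype_card, Fintype.card_fin]

/-- `#G / period = #Stab(x₀)`. [folklore] -/
theorem card_div_period_eq_card_stabilizer :
    Fintype.card G / MulAction.period σ x₀ = Nat.card (MulAction.stabilizer G x₀) := by
  have h := (MulAction.stabilizer G x₀).index_mul_card
  rw [MulAction.index_stabilizer, ← Nat.card_coe_set_eq, card_orbit_eq_period hσ x₀, Nat.card_eq_fintype_card] at h
  rw [← Nat.card_eq_fintype_card, ← h, Nat.mul_div_cancel_left _ (period_pos' x₀), Nat.card_eq_fintype_card]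

end Orbit

/-! ### Assembly over the orbits -/

section Total

variable {σ : G} {Y : Type*} (s : Y → X)

omit [Fintype G] in
/-- Distinct representatives have disjoint orbits. [folklore] -/
theorem eq_of_mem_orbit_of_mem_orbit (hs₂ : ∀ y y' : Y, s y' ∈ MulAction.orbit G (s y) → y = y')
    {x : X} {y y' : Y} (hy : x ∈ MulAction.orbit G (s y))
    (hy' : x ∈ MulAction.orbit G (s y')) : y = y' := by
  apply hs₂
  have h1 : MulAction.orbit G x = MulAction.orbit G (s y) := MulAction.orbit_eq_iff.mpr hy
  have h2 : MulAction.orbit G x = MulAction.orbit G (s y') := MulAction.orbit_eq_iff.mpr hy'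
  rw [← h1, h2]; exact MulAction.mem_orbit_self _

omit [Fintype G] in
/-- Elements of `∏_{y ∈ t} ℤ[orbit (s y)]` vanish off those orbits. [folklore] -/
theorem val_eq_zero_of_mem_finsetSup {t : Finset Y} {f : PermMod X}
    (hf : f ∈ t.sup fun y => orbitMod G (s y)) (x : X) (hx : ∀ y ∈ t, x ∉ MulAction.orbit G (s y)) :
    f.val x = 0 := by
  let K : Subgroup (PermMod X) :=
    { carrier := {f | f.val x = 0}
      one_mem' := rfl
      mul_mem' := fun {a b} ha hb => by show (a * b).val x = 0; rw [val_mul, ha, hb, add_zero]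
      inv_mem' := fun {a} ha => by show a⁻¹.val x = 0; rw [val_inv, ha, neg_zero] }
  have hle : (t.sup fun y => orbitMod G (s y)) ≤ K := Finset.sup_le fun y hy g hg => hg x (hx y hy)
  exact hle hf

omit [Fintype G] in
/-- The `ℤ[orbit (s y)]` are independent. [folklore] -/
theorem finsetSup_orbitMod_inf_eq_bot (hs₂ : ∀ y y' : Y, s y' ∈ MulAction.orbit G (s y) → y = y')
    (t : Finset Y) (y : Y) (hy : y ∉ t) :
    (t.sup fun y => orbitMod G (s y)) ⊓ orbitMod G (s y) = ⊥ := by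
  rw [eq_bot_iff]
  rintro f ⟨hft, hfy⟩
  rw [Subgroup.mem_bot]
  ext x
  rw [val_one]
  by_cases hx : x ∈ MulAction.orbit G (s y)
  · refine val_eq_zero_of_mem_finsetSup s hft x fun y' hy' hx' => hy ?_
    rwa [eq_of_mem_orbit_of_mem_orbit s hs₂ hx hx'] at *
  · exact hfy x hx

omit [Fintype G] in
/-- `ℤ[X] = ∏_{orbits} ℤ[orbit]`. [folklore] -/
theorem finsetSup_orbitMod_eq_top [Fintype Y] (hs₁ : ∀ x : X, ∃ y, x ∈ MulAction.orbit G (s y))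
    (hs₂ : ∀ y y' : Y, s y' ∈ MulAction.orbit G (s y) → y = y') :
    (Finset.univ.sup fun y => orbitMod G (s y)) = ⊤ := by
  rw [eq_top_iff]
  intro f _
  set piece : Y → PermMod X := fun y => PermMod.mk fun x => if x ∈ MulAction.orbit G (s y) then f.val x else 0
  have hpiece : ∀ y, piece y ∈ orbitMod G (s y) := fun y x hx => by
    show (if x ∈ MulAction.orbit G (s y) then f.val x else 0) = 0
    rw [if_neg hx]
  have hf : f = ∏ y, piece y := by
    ext x
    obtain ⟨y₀, hy₀⟩ := hs₁ x
    rw [val_prod, Finset.sum_eq_single y₀]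
    · show f.val x = if x ∈ MulAction.orbit G (s y₀) then f.val x else 0
      rw [if_pos hy₀]
    · intro y _ hne
      show (if x ∈ MulAction.orbit G (s y) then f.val x else 0) = 0
      rw [if_neg]
      exact fun h => hne (eq_of_mem_orbit_of_mem_orbit s hs₂ h hy₀)
    · intro h; exact absurd (Finset.mem_univ y₀) h
  rw [hf]
  exact Subgroup.prod_mem _ fun y _ => Finset.le_sup (f := fun y => orbitMod G (s y)) (Finset.mem_univ y) (hpiece y)

/-- **`#Ĥ⁻¹(⟨σ⟩, ℤ[X]) = 1`.** [cite: Childress2009, Ch. 4 §5 Prop. 5.10 (proof) (PDF p. 101)] -/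
theorem h1_top_eq_one [Fintype Y] (hσ : ∀ g : G, g ∈ Subgroup.zpowers σ)
    (hs₁ : ∀ x : X, ∃ y, x ∈ MulAction.orbit G (s y))
    (hs₂ : ∀ y y' : Y, s y' ∈ MulAction.orbit G (s y) → y = y') :
    Herbrand.h1 σ (⊤ : Subgroup (PermMod X)) ⊥ = 1 := by
  rw [← finsetSup_orbitMod_eq_top s hs₁ hs₂, Herbrand.h1_finsetSup_eq_prod _ _
    (fun y => isStable_orbitMod (s y)) (fun t y hy => finsetSup_orbitMod_inf_eq_bot s hs₂ t y hy)]
  exact Finset.prod_eq_one fun y _ => h1_orbitMod_eq_one hσ (s y)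

/-- **`#Ĥ⁰(⟨σ⟩, ℤ[X]) = ∏_{orbits} #Stab`.** [cite: Childress2009, Ch. 4 §5 Prop. 5.10 (proof) (PDF p. 101)] -/
theorem h0_top_eq_prod [Fintype Y] (hσ : ∀ g : G, g ∈ Subgroup.zpowers σ)
    (hs₁ : ∀ x : X, ∃ y, x ∈ MulAction.orbit G (s y))
    (hs₂ : ∀ y y' : Y, s y' ∈ MulAction.orbit G (s y) → y = y') :
    Herbrand.h0 σ (⊤ : Subgroup (PermMod X)) ⊥ = ∏ y, Nat.card (MulAction.stabilizer G (s y)) := by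
  rw [← finsetSup_orbitMod_eq_top s hs₁ hs₂, Herbrand.h0_finsetSup_eq_prod _ _
    (fun y => isStable_orbitMod (s y)) (fun t y hy => finsetSup_orbitMod_inf_eq_bot s hs₂ t y hy)]
  exact Finset.prod_congr rfl fun y _ => by
    rw [h0_orbitMod_eq hσ (s y), card_div_period_eq_card_stabilizer hσ (s y)]

end Total



end PermLattice

end Literature.NumberTheory.GaloisRepresentations
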